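import Literature.MathematicalPhysics.QuantumLattice.HubbardLangerMattisTorus
import HarnessLib

/-!
# The Langer–Mattis bound on the `4 × 4` torus in closed form (a kernel-checked number)

Topic `MathematicalPhysics/QuantumLattice`, family `hubbard`. Worked instance of
`LangerMattis.hubbardTorus_groundEnergyAt_ge` (`HubbardLangerMattisTorus.lean`) at `d = 2`, `L = 4`:
the momenta `2πk_i/4` have cosines `1, 0, -1, 0`, so the sixteen levels `ε_k = 2t(cos + cos)` of the
`4 × 4` torus take the values `±4t` (once each), `±2t` (four times each), `0` (six times), and the
Langer–Mattis / Kennedy–Lieb bound becomes the closed form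

  `E_{4×4}(N) ≥ (U/2) N - 4U - (2√(16t² + U²/16) + 8√(4t² + U²/16) + 6·|U|/4)`

(`hubbardTorusFour_groundEnergyAt_ge`), valid for all real `t`, `U` and `N ≤ 32`. At `t = 1`, `U = 4`,
half filling `N = 16` this is `10 - 2√17 - 8√5 = -16.1347550…`; the decimals
`-19.5546805, -16.1347553, -13.5440040, -11.5716891, -8.8444104 ≤ E_{4×4}(16)` for `U = 2, 4, 6, 8, 12` are
proved in the kernel (`hubbardTorusFour_halfFilling_ge`, `…_U4_ge`; square roots bounded by
`√x ≤ a ⇐ x ≤ a²`). These are the certified "FK/Langer–Mattis `4×4` lower bounds" of the many-body-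
bootstrap packet (obtained there by exact rational inertia counts); here they are reproduced by Lean
alone — no numerical input. Everything is proved; `cosFour` is bookkeeping.

## References

* W. D. Langer, D. C. Mattis, Phys. Lett. 36A (1971) 139–140, eqs. (3)–(5). [LangerMattis1971]
* T. Kennedy, E. H. Lieb, Physica A 138 (1986) 320–358, Theorem 2.1. [KennedyLieb1986]

## Mathlib / tree search

Tree (REUSED): `LangerMattis.hubbardTorus_groundEnergyAt_ge`, `latticeMomentum`. Mathlib:
`piFinTwoEquiv`, `Fintype.sum_equiv`, `Fintype.sum_prod_type`, `Fin.sum_univ_four`,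
`Real.cos_pi_div_two`, `Real.cos_pi`, `Real.cos_add_pi`, `Real.sqrt_le_sqrt`, `Real.sqrt_sq`.
-/

noncomputable section

namespace Literature.MathematicalPhysics.QuantumLattice

namespace LangerMattis

open Finset Literature.Probability.LatticeModels ThermodynamicLimit

/-- The cosines of the four momenta `2πv/4`, `v = 0, 1, 2, 3`: `1, 0, -1, 0` (any other argument
is sent to `0`). [folklore] -/
def cosFour : ℕ → ℝ
  | 0 => 1
  | 2 => -1
  | _ => 0

/-- `cos(2πk_i/4) ∈ {1, 0, -1, 0}` according to `k_i mod 4`. [folklore] -/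
theorem cos_latticeMomentum_four (k : TorusSite 2 4) (i : Fin 2) :
    Real.cos (latticeMomentum 4 k i) = cosFour (k i).val := by
  unfold latticeMomentum
  have hv : (k i).val < 4 := ZMod.val_lt (k i)
  generalize (k i).val = v at hv ⊢
  interval_cases v
  · simp [cosFour]
  · have h : 2 * Real.pi * ((1 : ℕ) : ℝ) / (4 : ℕ) = Real.pi / 2 := by push_cast; ring
    rw [h, Real.cos_pi_div_two]
    rfl
  · have h : 2 * Real.pi * ((2 : ℕ) : ℝ) / (4 : ℕ) = Real.pi := by push_cast; ring
    rw [h, Real.cos_pi]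
    rfl
  · have h : 2 * Real.pi * ((3 : ℕ) : ℝ) / (4 : ℕ) = Real.pi / 2 + Real.pi := by push_cast; ring
    rw [h, Real.cos_add_pi, Real.cos_pi_div_two, neg_zero]
    rfl

/-- **The Langer–Mattis momentum sum of the `4 × 4` torus in closed form**:
`Σ_{k ∈ (ℤ/4)²} √((2t(cos(πk₁/2) + cos(πk₂/2)))² + U²/16) = 2√(16t²+U²/16) + 8√(4t²+U²/16) + 6|U/4|`.
[cite: LangerMattis1971, eq. (3)] -/
theorem momentumSum_four (t U : ℝ) :
    ∑ k : TorusSite 2 4,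
        Real.sqrt ((t * (2 * ∑ i, Real.cos (latticeMomentum 4 k i))) ^ 2 + (U / 4) ^ 2) =
      2 * Real.sqrt (16 * t ^ 2 + (U / 4) ^ 2) + 8 * Real.sqrt (4 * t ^ 2 + (U / 4) ^ 2) +
        6 * |U / 4| := by
  set F : ℝ → ℝ := fun s => Real.sqrt ((t * (2 * s)) ^ 2 + (U / 4) ^ 2) with hF
  have h1 : ∑ k : TorusSite 2 4,
      Real.sqrt ((t * (2 * ∑ i, Real.cos (latticeMomentum 4 k i))) ^ 2 + (U / 4) ^ 2) =
      ∑ ab : Fin 4 × Fin 4, F (cosFour ab.1.val + cosFour ab.2.val) := by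
    refine Fintype.sum_equiv (piFinTwoEquiv fun _ => ZMod 4) _ _ fun k => ?_
    rw [Fin.sum_univ_two, cos_latticeMomentum_four, cos_latticeMomentum_four]
    rfl
  have hneg : ∀ s, F (-s) = F s := fun s => by
    simp only [hF]
    congr 1
    ring
  have e2 : F 2 = Real.sqrt (16 * t ^ 2 + (U / 4) ^ 2) := by
    simp only [hF]
    congr 1
    ring
  have e1 : F 1 = Real.sqrt (4 * t ^ 2 + (U / 4) ^ 2) := by
    simp only [hF]
    congr 1
    ring
  have e0 : F 0 = |U / 4| := by
    simp only [hF]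
    rw [show (t * (2 * (0 : ℝ))) ^ 2 + (U / 4) ^ 2 = (U / 4) ^ 2 by ring, Real.sqrt_sq_eq_abs]
  have hv : (0 : Fin 4).val = 0 ∧ (1 : Fin 4).val = 1 ∧ (2 : Fin 4).val = 2 ∧ (3 : Fin 4).val = 3 :=
    ⟨rfl, rfl, rfl, rfl⟩
  have hc : cosFour 0 = 1 ∧ cosFour 1 = 0 ∧ cosFour 2 = -1 ∧ cosFour 3 = 0 := ⟨rfl, rfl, rfl, rfl⟩
  rw [h1, Fintype.sum_prod_type]
  simp only [Fin.sum_univ_four, hv.1, hv.2.1, hv.2.2.1, hv.2.2.2, hc.1, hc.2.1, hc.2.2.1, hc.2.2.2]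
  norm_num only
  rw [hneg 1, hneg 2, e2, e1, e0]
  ring

/-- **Langer–Mattis–Kennedy–Lieb on the `4 × 4` torus, closed form.** For all real `t`, `U` and
`N ≤ 32`:
`E_{4×4}(N) ≥ (U/2)N - 4U - (2√(16t² + U²/16) + 8√(4t² + U²/16) + 6|U/4|)`.
[cite: LangerMattis1971, eqs. (3)–(5)][cite: KennedyLieb1986, Theorem 2.1] -/
theorem hubbardTorusFour_groundEnergyAt_ge (t U : ℝ) {N : ℕ} (hN : N ≤ 32) :
    U / 2 * N - (4 * U + (2 * Real.sqrt (16 * t ^ 2 + (U / 4) ^ 2) +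
        8 * Real.sqrt (4 * t ^ 2 + (U / 4) ^ 2) + 6 * |U / 4|)) ≤
      groundEnergyAt (fermionTorusGraph 2 4) t U N := by
  haveI : NeZero (4 : ℕ) := ⟨by norm_num⟩
  have h := hubbardTorus_groundEnergyAt_ge (d := 2) (L := 4) ⟨2, rfl⟩ (by norm_num) t U
    (N := N) (by norm_num; exact hN)
  rw [momentumSum_four] at h
  have h4 : U / 4 * ((4 : ℕ) : ℝ) ^ 2 = 4 * U := by push_cast; ring
  rw [h4] at h
  exact h

/-- **Kernel-checked numbers**: at `t = 1`, half filling `N = 16`, for `U = 2, 4, 6, 8, 12`,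
`E_{4×4}(16) ≥ -19.5546805, -16.1347553, -13.5440040, -11.5716891, -8.8444104`
(`= 5U/2 - 2√(16 + U²/16) - 8√(4 + U²/16)` rounded down at `10⁻⁷`). These are exactly the certified
"FK/Langer–Mattis `4×4` lower bounds" of the many-body-bootstrap packet (obtained there by exact
rational inertia counts), reproduced inside Lean with decimal square-root bounds.
[cite: LangerMattis1971, eqs. (3)–(5)][cite: KennedyLieb1986, Theorem 2.1] -/
theorem hubbardTorusFour_halfFilling_ge :
    (-19.5546805 : ℝ) ≤ groundEnergyAt (fermionTorusGraph 2 4) 1 2 16 ∧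
    (-16.1347553 : ℝ) ≤ groundEnergyAt (fermionTorusGraph 2 4) 1 4 16 ∧
    (-13.5440040 : ℝ) ≤ groundEnergyAt (fermionTorusGraph 2 4) 1 6 16 ∧
    (-11.5716891 : ℝ) ≤ groundEnergyAt (fermionTorusGraph 2 4) 1 8 16 ∧
    (-8.8444104 : ℝ) ≤ groundEnergyAt (fermionTorusGraph 2 4) 1 12 16 := by
  refine ⟨?_, ?_, ?_, ?_, ?_⟩
  · have h := hubbardTorusFour_groundEnergyAt_ge 1 2 (N := 16) (by norm_num)
    have ha : Real.sqrt (16 * (1 : ℝ) ^ 2 + (2 / 4) ^ 2) ≤ 4.0311288742 :=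
      (Real.sqrt_le_sqrt (by norm_num)).trans_eq (Real.sqrt_sq (by norm_num))
    have hb : Real.sqrt (4 * (1 : ℝ) ^ 2 + (2 / 4) ^ 2) ≤ 2.0615528129 :=
      (Real.sqrt_le_sqrt (by norm_num)).trans_eq (Real.sqrt_sq (by norm_num))
    have habs : |(2 : ℝ) / 4| = 1 / 2 := by norm_num
    rw [habs] at h
    push_cast at h
    linarith
  · have h := hubbardTorusFour_groundEnergyAt_ge 1 4 (N := 16) (by norm_num)
    have ha : Real.sqrt (16 * (1 : ℝ) ^ 2 + (4 / 4) ^ 2) ≤ 4.12310563 :=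
      (Real.sqrt_le_sqrt (by norm_num)).trans_eq (Real.sqrt_sq (by norm_num))
    have hb : Real.sqrt (4 * (1 : ℝ) ^ 2 + (4 / 4) ^ 2) ≤ 2.23606798 :=
      (Real.sqrt_le_sqrt (by norm_num)).trans_eq (Real.sqrt_sq (by norm_num))
    have habs : |(4 : ℝ) / 4| = 1 := by norm_num
    rw [habs] at h
    push_cast at h
    linarith
  · have h := hubbardTorusFour_groundEnergyAt_ge 1 6 (N := 16) (by norm_num)
    have ha : Real.sqrt (16 * (1 : ℝ) ^ 2 + (6 / 4) ^ 2) ≤ 4.2720018728 :=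
      (Real.sqrt_le_sqrt (by norm_num)).trans_eq (Real.sqrt_sq (by norm_num))
    have hb : Real.sqrt (4 * (1 : ℝ) ^ 2 + (6 / 4) ^ 2) ≤ 2.5 :=
      (Real.sqrt_le_sqrt (by norm_num)).trans_eq (Real.sqrt_sq (by norm_num))
    have habs : |(6 : ℝ) / 4| = 3 / 2 := by norm_num
    rw [habs] at h
    push_cast at h
    linarith
  · have h := hubbardTorusFour_groundEnergyAt_ge 1 8 (N := 16) (by norm_num)
    have ha : Real.sqrt (16 * (1 : ℝ) ^ 2 + (8 / 4) ^ 2) ≤ 4.4721359551 :=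
      (Real.sqrt_le_sqrt (by norm_num)).trans_eq (Real.sqrt_sq (by norm_num))
    have hb : Real.sqrt (4 * (1 : ℝ) ^ 2 + (8 / 4) ^ 2) ≤ 2.8284271248 :=
      (Real.sqrt_le_sqrt (by norm_num)).trans_eq (Real.sqrt_sq (by norm_num))
    have habs : |(8 : ℝ) / 4| = 2 := by norm_num
    rw [habs] at h
    push_cast at h
    linarith
  · have h := hubbardTorusFour_groundEnergyAt_ge 1 12 (N := 16) (by norm_num)
    have ha : Real.sqrt (16 * (1 : ℝ) ^ 2 + (12 / 4) ^ 2) ≤ 5 :=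
      (Real.sqrt_le_sqrt (by norm_num)).trans_eq (Real.sqrt_sq (by norm_num))
    have hb : Real.sqrt (4 * (1 : ℝ) ^ 2 + (12 / 4) ^ 2) ≤ 3.6055512755 :=
      (Real.sqrt_le_sqrt (by norm_num)).trans_eq (Real.sqrt_sq (by norm_num))
    have habs : |(12 : ℝ) / 4| = 3 := by norm_num
    rw [habs] at h
    push_cast at h
    linarith

/-- The `U = 4` number alone (the packet's headline `4 × 4` FK/LM row): `E_{4×4}(16) ≥ -16.1347553`
at `t = 1`, `U = 4`. [cite: LangerMattis1971, eqs. (3)–(5)][cite: KennedyLieb1986, Theorem 2.1] -/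
theorem hubbardTorusFour_halfFilling_U4_ge :
    (-16.1347553 : ℝ) ≤ groundEnergyAt (fermionTorusGraph 2 4) 1 4 16 :=
  hubbardTorusFour_halfFilling_ge.2.1

end LangerMattis

end Literature.MathematicalPhysics.QuantumLattice
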